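import Mathlib
import Literature.Geometry.Lorentzian.GiorgiKlainermanSzeftel2022.FullRWInteriorLedger

/-!
# Giorgi–Klainerman–Szeftel, chapter 12 below Proposition 12.4.6: the printed budgets and the printed algebra of §12.1–12.3

CITATION HEADER (lean-in-tree rule 2026-08-18).  Kernel-checked transcription of (a) the INTEGER BOOKKEEPING (numbers of
derivatives assumed, displayed and concluded), (b) the displayed COMPLEX-SCALAR ALGEBRA of the factorisation lemmas, and (c) the
elementary REAL ARITHMETIC of the absorption / Young / weight-shift steps printed in chapter 12, §12.1–§12.3 ("Decay estimates
for `α̲`": Preliminaries, Control of the full gRW equation for `𝔮̲`, Transport estimates for `A̲` — the interior of the proof of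
Theorem M2 BELOW Thm 12.4.5 / Prop 12.4.6, whose own Steps are the sibling `TheoremM1M2Ledger` §3) of
* [J]  E. Giorgi, S. Klainerman, J. Szeftel, *Wave equations estimates and the nonlinear stability of slowly rotating Kerr
  black holes*, Pure Appl. Math. Q. **20** (2024) no. 7, 2865–3849 = bib key `GiorgiKlainermanSzeftel2024` — the PRIMARY text,
  read in the held per-page text of `doi:10.4310/pamq.241128023033` (`[J] p.N Lm` = per-page file N, line m; PDF page N, the
  printed folio is N−1);
* [v1] arXiv:2205.14808v1, TeX source `FinalKerrarxivversion.tex` (`l.N`) = bib key `GiorgiKlainermanSzeftel2022` — quoted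
  beside it.  Differences met in THIS range, each recorded where it is used: [J] Cor 12.2.5 / Lemma 12.2.6 stand in §12.2.2
  ([v1] states the lemma only in §12.4, as [J]'s Lemma 12.4.8 restates it); [J] Remark 12.1.1 restricts the gauge condition
  (12.1.3) to `𝓜(τ ≤ τ_* − 2)` ([v1]'s remark, l.22614–22617, has no such restriction — the collar is [J]-only, cf.
  `TheoremM1M2Ledger` §2); [J] p.559 L78–p.560 L6 prints `|p|` and `λ = |p|/2` where [v1] l.23234–23240 prints `p` and `λ = p/2`
  (with `p ≤ −δ < 0`; `v1_lambda_sign`); [J] p.550 L20 prints `3e₄(r)/r` where [v1] l.22815 prints `3e₃(r)/r`; every integer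
  below is printed identically in both unless its docstring says "[J]-only";
with, for the one junction datum, the SUPPLY side typed in the sibling `FullRWInteriorLedger` §2 from [KS] = S. Klainerman,
J. Szeftel, *Kerr stability for small angular momentum*, PAMQ **19** (2023) = `KlainermanSzeftel2023` (HAL hal-04280491) / [v1]
arXiv:2104.11857 = `KlainermanSzeftel2021` (`ksGlobalTop ks = k_small + 125`, `ksPrimedTop ks = k_small + 129`), and the calibration
integer `schwKloss = 33` of [53] = `KlainermanSzeftel2020` Lemma 5.1, which [J] Lemma 12.2.8's proof cites ("see Lemma 5.1 in [53]").
USED BY NAME: `TheoremM1M2Ledger.kL ks = ks + 120`, `TheoremM1M2Ledger.t1224Top` (the order at which §12.4 Step 1 invokes Cor 12.2.5),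
`FullRWInteriorLedger.hypTop`, `prop1164Consumed`, `hypConsumedLiteral`, `ksGlobalTop`, `ksPrimedTop`, `schwKloss`.

WHAT IS TRANSCRIBED (every ℕ-valued `def` is a printed integer; argument `ks` = `k_small`):
* §0 the STATED ranges: hypotheses (12.1.1)–(12.1.2) "for all `k ≤ k_L`"; Thm 12.2.3, Thm 12.2.4, Cor 12.2.5, Lemma 12.2.6, Prop 12.2.7,
  Prop 12.2.9 "`s ≤ k_L`"; Lemma 12.2.8 (no `s` in its statement; its proof: "For higher derivatives, `s ≤ k_L`"); §12.3.6's
  iteration "for some `0 ≤ s ≤ k_L − 1`" ⇒ "for all `0 ≤ s ≤ k_L`";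
* §1 the DISPLAYED derivative costs: (12.1.9) `N_err = Ñ_err + 𝔡^{≤3}(Γ_g·Γ_b)`, `Ñ_err = r²𝔡^{≤2}(Γ_b·(A,B))`; Lemma 12.2.8's proof
  `𝔡^{≤s}(N_err − Ñ_err) = 𝔡^{≤3+s}Γ_g·𝔡^{≤k_L/2}Γ_b + 𝔡^{≤k_L/2}Γ_g·𝔡^{≤3+s}Γ_b`; the transport system (12.3.5) = Cor 12.1.4
  (`r𝔡^{≤1}(Γ_g·Γ_b)`), the transport estimate applied to it (Prop 12.3.5's proof: `r²|𝔡^{≤2}(Γ_g·Γ_b)|²`), Lemma 12.3.9's (12.3.11)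
  (`𝔡^{≤1}(Γ_b·Γ_b)`), Lemma 12.3.10 (`r^{p+1}|𝔡^{≤2}(Γ_b·Γ_g)|²`), §12.3.6's commuted systems (`r𝔡^{≤2}(Γ_g·Γ_b)`); and the
  CONSUMED orders they add up to;
* §2 the displayed ALGEBRA of complex scalars, with `x = tr χ` (real, `≠ 0`), `y = ⁽ᵃ⁾tr χ` (real), `tr X = tr χ − i ⁽ᵃ⁾tr χ`
  (so `conj(tr X) = x + iy`, `|tr X|² = x² + y²`, `Re((tr X)²) = x² − y²`): the definitions (12.1.4) of `C̲₁`, `C̲₂`; the three displayed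
  identities of the proof of Lemma 12.1.2 (`4 tr X − 2|tr X|²/tr χ = C̲₁`; the evaluation of `∇₄(2 tr X − (3/2)|tr X|²/tr χ)` under
  the QUOTED rule `∇₄ tr X = −½(tr X)² + r^{−2}𝔡^{≤1}Γ_g`; `… + (2 tr X − ½|tr X|²/tr χ)(2 tr X − (3/2)|tr X|²/tr χ) = C̲₂`); the
  rewriting of `Ψ̲`'s coefficient in the proof of Cor 12.1.4; the choice of `h` and the remainder in the proof of Lemma 12.3.7; and,
  since (11.1.5) prints the SAME two formulas for `C₁`, `C₂` (with `tr χ̲`, `⁽ᵃ⁾tr χ̲`), the two leading-part identities `C̃₁ = C₁ + …`,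
  `C̃₂ = C₂ + …` of the proof of [J] Lemma 11.1.3 — each an identity of rational functions of `(x, y)` with `i² = −1`, NOTHING about
  the Ricci coefficients, the null structure equations or the error classes `r^{−p}𝔡^{≤k}Γ`;
* §3 elementary real arithmetic in the SHAPE of: Step 3 of the proof of Thm 12.2.4 ("as well as the smallness of `|a|/m`": an
  absorption under an explicit smallness hypothesis); Cor 12.2.5 ⇐ Thm 12.2.4 + Lemma 12.2.6 (Young; the exponent `−2 − 3δ_dec + p + δ`
  is `2·(−1 − (3/2)δ_dec + (p+δ)/2)`); the choice `λ = |p|/2` in the proof of (12.3.2); Prop 12.3.5's "Replacing `p` with `p − 2`";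
  the bootstrap convention `ε = ε₀^{2/3}` turning the displayed `ε⁴` of (12.3.11) into the `ε₀²` of the next line and the `ε²` of
  Lemma 12.2.8's proof into `ε₀`;
* §4 the ℕ-induction scheme of §12.3.6 (base `s = 0`, step `s ↦ s + 1` for `0 ≤ s ≤ k_L − 1`, conclusion `0 ≤ s ≤ k_L`);
* §5 linear ℚ-arithmetic on the decay exponents displayed in the proof of Lemma 12.2.8 at `s = 0` and in (12.3.11).

WHAT IS CERTIFIED.  ℕ-arithmetic (§0–§1, §4), identities in the field `ℂ` / ordered field `ℝ` (§2–§3) and linear ℚ-arithmetic (§5)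
ONLY (0 sorry).  ONE JUNCTION DATUM in integers — which printed RANGE covers which printed USE, nothing about the validity of any estimate:
(K-A) hypotheses (12.1.1)–(12.1.2) are STATED "for all `k ≤ k_L`"; Lemma 12.2.8's proof differentiates `N_err − Ñ_err = 𝔡^{≤3}(Γ_g·Γ_b)`
  `s` more times "for higher derivatives, `s ≤ k_L`", so at its top it CONSUMES (12.1.1) at order `k_L + 3`, three above the stated
  range (`lem1228_overshoot`) — and, unlike ch. 11 (cf. `FullRWInteriorLedger`, J-A), the text PRINTS at this spot the device that pays
  for it: "we use an additional `τ₁^{δ₀}` by a standard interpolation argument, see Lemma 5.1 in [53]" (`interp_pointer` records only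
  that `3 ≤ 33 = k_loss` of the cited lemma); the printed low factor `𝔡^{≤k_L/2}` is short of Leibniz's `⌊(s+3)/2⌋` by `1` or `2` at the
  top, harmlessly (`low_factor_datum`: it stays `≤ k_L`);
(K-B) the transport side (Prop 12.2.9 via §12.3) consumes `(Γ_g, Γ_b)` at order `k_L + 2` at its top (`prop1229_overshoot`; the `2` is
  DISPLAYED at `s = 0` — Prop 12.3.5's proof, (12.3.12) — and for the commuted sources at `s = 1`; linearity in `s` is our reading of
  "by iteration"); the literal total of §12.1–12.3 is `k_L + 3` (`ch12_literal_consumption`), one LESS than ch. 11's `k_L + 4`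
  (`ch12_vs_ch11`);
(K-C) unlike §11.7.3 (which invokes Thms 11.6.1/11.6.2 below their tops, `FullRWInteriorLedger.sec1173_nonbinding`), §12.4 Step 1 invokes
  Cor 12.2.5 "for `s ≤ k_L`" = AT its stated top (`TheoremM1M2Ledger.t1224Top = kL`), so the use does not lower the consumed order
  (`sec124_use_at_top`); and EVERY consumed order is covered by the [KS] supply: `k_L + 3 ≤ k_small + 125 = k_L + 5` (margin `2`;
  `3` for the transport side; `6` on the primed frame), `ks_supply_covers_ch12`.
The words "interpolation", "Bianchi", "null structure equation", "bootstrap assumptions", "integration by parts", "Hodge elliptic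
estimates" are QUOTED, never proved.  NOTHING about the Einstein / gRW / Teukolsky equations, the tensors `A̲, 𝔮̲, Ψ̲`, the norms
`BEF, B, E, F, N, Ḃ`, the vectorfields, the divergence theorem, the decay RATES as estimates, or the truth of any inequality of [J] is
asserted: in §3 every printed estimate enters as a real-number HYPOTHESIS of the stated shape and only the arithmetic of combining them
is checked.

VERSION.  v2 = v1 (p184781) with four citation loci corrected in docstrings (p.582 line numbers; the `Γ_b·Γ_b` print datum of (12.3.11)
attributed to [v1] only); no declaration, statement or proof changed.

STATUS-RELATION.  `TheoremM1M2Ledger` §3 starts from Cor 12.2.5 / Lemma 12.4.8 "for `s ≤ k_L`" (`t1224Top`); this module itemises what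
lies BELOW that input in §12.1–12.3 and re-derives nothing of §12.4.  `FullRWInteriorLedger` (ch. 11, §11.1–11.6) is the sibling whose
format is followed; its [KS]-supply constants are imported, not re-typed.  The rate constants of (12.1.1)–(12.1.2) (`r²τ^{1/2+δ_dec} +
rτ^{1+δ_dec}`, `rτ^{1+δ_dec}`, `r^{7/2+δ_dec}`) enter §5 only as the ℚ-exponents printed in Lemma 12.2.8's proof.
-/

namespace Literature.Geometry.Lorentzian.GiorgiKlainermanSzeftel2022.AbarDecayInteriorLedger

open Literature.Geometry.Lorentzian.GiorgiKlainermanSzeftel2022.TheoremM1M2Ledger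
open Literature.Geometry.Lorentzian.GiorgiKlainermanSzeftel2022.FullRWInteriorLedger

/-! ## §0 Stated ranges of [J] §12.1–12.3 (argument `ks` = k_small; `kL ks = ks + 120`) -/

/-- (12.1.1)–(12.1.2): "We assume in fact for all `k ≤ k_L` ([v1] l.22595: "for all for all", sic), with `k_L = k_small + 120`,
`(r²τ^{1/2+δ_dec} + rτ^{1+δ_dec})|𝔡^{≤k}Γ_g| ≤ ε`, `rτ^{1+δ_dec}|𝔡^{≤k}Γ_b| ≤ ε` … for `k ≤ k_L`, `r^{7/2+δ_dec}|𝔡^{≤k}(A,B)| ≤ ε`."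
The top of the hypotheses' range (the same number as ch. 11's `FullRWInteriorLedger.hypTop`).
[cite: GiorgiKlainermanSzeftel2024, (12.1.1)–(12.1.2), p.544 L14–31; GiorgiKlainermanSzeftel2022, l.22595–22607] -/
def hyp12Top (ks : ℕ) : ℕ := kL ks

/-- The lower end of the `s`-ranges of ch. 12: the statements print "`s ≤ k_L`" with no lower end; §12.3.6 concludes "for all `s`
such that `0 ≤ s ≤ k_L`" (ch. 11 prints `2 ≤ s`, `FullRWInteriorLedger.sLow = 2`).
[cite: GiorgiKlainermanSzeftel2024, §12.3.6, p.582 L11–12; GiorgiKlainermanSzeftel2022, l.24136] -/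
def sLow12 : ℕ := 0

/-- Thm 12.2.3, (12.2.1): "for all `s ≤ k_L`, δ ≤ p ≤ 2 − δ".
[cite: GiorgiKlainermanSzeftel2024, Thm 12.2.3, p.551 L48–56; GiorgiKlainermanSzeftel2022, l.22893–22905] -/
def thm1223Top (ks : ℕ) : ℕ := kL ks

/-- Thm 12.2.4, (12.2.2): "The following holds true for `s ≤ k_L`, for all `δ ≤ p ≤ 2 − δ`,
`BEF^s_p[ψ̲, A̲](τ₁, τ₂) ≲ E^s_p[ψ̲, A̲](τ₁) + N^s_p[ψ̲, Ñ_err](τ₁, τ₂) + ε₀²τ₁^{−2−2δ_dec}`".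
[cite: GiorgiKlainermanSzeftel2024, Thm 12.2.4, p.552 L5–17; GiorgiKlainermanSzeftel2022, Thm `Thm:Nondegenerate-Morawetz-psib`, l.22913–22922] -/
def thm1224Top (ks : ℕ) : ℕ := kL ks

/-- Cor 12.2.5, (12.2.3): "Under the same assumptions as in Theorem 12.2.4 we derive, for `s ≤ k_L`,
`BEF^s_p[ψ̲, A̲](τ₁, τ₂) ≲ E^s_p[ψ̲, A̲](τ₁) + ε₀²τ₁^{−2−3δ_dec+p+δ} + ε₀²τ₁^{−2−2δ_dec}`, `δ ≤ p ≤ 1 − δ`.  This is an immediate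
consequence of Theorem 12.2.4 and the lemma below."  [J]-only at this position ([v1] derives the analogue inside §12.4, Step 1,
l.24373–24379, "for `s ≤ k_L`", with right-hand side `E^s_p[ψ̲, A̲](τ₁) + ε₀²τ₁^{−2−3δ_dec+p+δ}` — no separate `ε₀²τ₁^{−2−2δ_dec}` term).
This is the statement §12.4 Step 1 invokes "for `s ≤ k_L`" (`TheoremM1M2Ledger.t1224Top`).
[cite: GiorgiKlainermanSzeftel2024, Cor 12.2.5, p.552 L18–28, Step 1 (12.4.10), p.587 L90–97] -/
def cor1225Top (ks : ℕ) : ℕ := kL ks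

/-- Lemma 12.2.6, (12.2.4): "We have for all `δ ≤ p ≤ 1 − δ` and `s ≤ k_L`,
`N^s_p[ψ̲, Ñ_err](τ₁, τ₂) ≲ ε₀τ₁^{−1−(3/2)δ_dec+(p+δ)/2}(BEF^s_p[ψ̲](τ₁, τ₂))^{1/2}`.  Proof … postponed to Section 12.4.2."
[J]-only at this position (= [J] Lemma 12.4.8 = [v1] Lemma `lemma:estimateforN_{err}-chap12`, l.24330).
[cite: GiorgiKlainermanSzeftel2024, Lemma 12.2.6, p.552 L29–47, Lemma 12.4.8, p.586 L33–44; GiorgiKlainermanSzeftel2022, l.24330] -/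
def lem1226Top (ks : ℕ) : ℕ := kL ks

/-- Prop 12.2.7, (12.2.5) (Step 1 of the proof of Thm 12.2.4): "for all `s ≤ k_L` and all `δ ≤ p ≤ 2 − δ`.
`BEF^s_p[ψ̲] ≲ E^s_p[ψ̲](τ₁) + O(a)BEF^s_p[ψ̲, A̲] + N^s_p[ψ̲, Ñ_err] + ε₀²τ₁^{−2−2δ_dec}`".
[cite: GiorgiKlainermanSzeftel2024, Prop 12.2.7, p.552 L62–71; GiorgiKlainermanSzeftel2022, Prop `prop:Step1-undpsi`, l.22938–22946] -/
def prop1227Top (ks : ℕ) : ℕ := kL ks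

/-- Lemma 12.2.8, (12.2.6), is stated "For `δ ≤ p ≤ 2 − δ`" with NO `s`-range although its norms carry the superscript `s`; its proof
supplies it: "which proves the estimate … in the case `s = 0`.  For higher derivatives, `s ≤ k_L`, we write schematically …".
[cite: GiorgiKlainermanSzeftel2024, Lemma 12.2.8, p.553 L7–20, proof, p.555 L13–15; GiorgiKlainermanSzeftel2022, Lemma `lemma:DecayfortheNterm-undpsi`, l.22951–22960, l.23035–23037] -/
def lem1228HighTop (ks : ℕ) : ℕ := kL ks

/-- Prop 12.2.9 (Step 2): (12.2.7) "for `s ≤ k_L`, for all `δ ≤ p ≤ 2 − δ`", `BEF^s_p[A̲] ≲ B^s_δ[ψ̲] + E^s_p[A̲](τ₁) + ε₀²τ₁^{−2−2δ_dec}`;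
(12.2.8) "for `s ≤ k_L`, for all `δ ≤ p ≤ 1 − δ`" (the additional control on `Σ(τ)`).  "The proof … is given in Section 12.3."
[cite: GiorgiKlainermanSzeftel2024, Prop 12.2.9, p.553 L21–51; GiorgiKlainermanSzeftel2022, Prop `prop:MaiTransportAb-steps`, l.22966–22979] -/
def prop1229Top (ks : ℕ) : ℕ := kL ks

/-- §12.3.6, the iteration hypothesis: "assuming that (12.2.7) and (12.2.8) hold for some `0 ≤ s ≤ k_L − 1`.  It it [sic] true for
`s = 0` by the above, and our goal is to prove that (12.2.7) and (12.2.8) hold with `s` replaced by `s + 1`."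
[cite: GiorgiKlainermanSzeftel2024, §12.3.6 item 1, p.580 L73–77; GiorgiKlainermanSzeftel2022, l.24093–24095] -/
def iterHyp12Top (ks : ℕ) : ℕ := kL ks - 1

/-- Unfolding lemma. [folklore] -/
@[simp] lemma hyp12Top_def (ks : ℕ) : hyp12Top ks = kL ks := rfl
/-- Unfolding lemma. [folklore] -/
@[simp] lemma sLow12_def : sLow12 = 0 := rfl
/-- Unfolding lemma. [folklore] -/
@[simp] lemma thm1223Top_def (ks : ℕ) : thm1223Top ks = kL ks := rfl
/-- Unfolding lemma. [folklore] -/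
@[simp] lemma thm1224Top_def (ks : ℕ) : thm1224Top ks = kL ks := rfl
/-- Unfolding lemma. [folklore] -/
@[simp] lemma cor1225Top_def (ks : ℕ) : cor1225Top ks = kL ks := rfl
/-- Unfolding lemma. [folklore] -/
@[simp] lemma lem1226Top_def (ks : ℕ) : lem1226Top ks = kL ks := rfl
/-- Unfolding lemma. [folklore] -/
@[simp] lemma prop1227Top_def (ks : ℕ) : prop1227Top ks = kL ks := rfl
/-- Unfolding lemma. [folklore] -/
@[simp] lemma lem1228HighTop_def (ks : ℕ) : lem1228HighTop ks = kL ks := rfl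
/-- Unfolding lemma. [folklore] -/
@[simp] lemma prop1229Top_def (ks : ℕ) : prop1229Top ks = kL ks := rfl
/-- Unfolding lemma. [folklore] -/
@[simp] lemma iterHyp12Top_def (ks : ℕ) : iterHyp12Top ks = kL ks - 1 := rfl

/-- Every statement of §12.2 and the hypotheses print the one top `k_L`; the iteration's last step `s = k_L − 1 ↦ k_L` lands on it;
the hypotheses' top is ch. 11's. [folklore] -/
theorem stated_tops12 (ks : ℕ) :
    thm1223Top ks = hyp12Top ks ∧ thm1224Top ks = hyp12Top ks ∧ cor1225Top ks = hyp12Top ks ∧ lem1226Top ks = hyp12Top ks ∧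
    prop1227Top ks = hyp12Top ks ∧ lem1228HighTop ks = hyp12Top ks ∧ prop1229Top ks = hyp12Top ks ∧
    iterHyp12Top ks + 1 = prop1229Top ks ∧ sLow12 ≤ iterHyp12Top ks ∧ hyp12Top ks = hypTop ks ∧ sLow12 < sLow := by
  dsimp only [thm1223Top_def, thm1224Top_def, cor1225Top_def, lem1226Top_def, prop1227Top_def, lem1228HighTop_def,
    prop1229Top_def, iterHyp12Top_def, hyp12Top_def, hypTop_def, sLow12_def, sLow_def, kL_def]
  omega

/-! ## §1 Displayed derivative costs and the orders they consume -/

/-- (12.1.9) ("given schematically by the expression (5.3.10) which we recall below"): "`N_err = Ñ_err + 𝔡^{≤3}(Γ_g·Γ_b)`, `Ñ_err = r²𝔡^{≤2}(Γ_b·(A, B))`, with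
`Ñ_err` the principal term in `N_err` with respect to decay in `r`"; Step 1 of §12.2.3 recalls "`N_err = Ñ_err + 𝔡^{≤3}(Γ_b·Γ_g)`".
The inner order of the non-principal part.
[cite: GiorgiKlainermanSzeftel2024, (12.1.9), p.546 L46–60, Step 1, p.552 L56–61; GiorgiKlainermanSzeftel2022, (12.1.9) `eq:N_err-Ab`, l.22681–22686, l.22935] -/
def nerrInner : ℕ := 3

/-- (12.1.9): the inner order `2` of the principal part `Ñ_err = r²𝔡^{≤2}(Γ_b·(A, B))` (the same `2` as ch. 11's `N_g`,
`FullRWInteriorLedger.ngInner`).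
[cite: GiorgiKlainermanSzeftel2024, (12.1.9), p.546 L46–60; GiorgiKlainermanSzeftel2022, l.22683–22686] -/
def ntInner : ℕ := 2

/-- Proof of Lemma 12.2.8, higher derivatives: "For higher derivatives, `s ≤ k_L`, we write schematically
`𝔡^{≤s}(N_err − Ñ_err) = 𝔡^{≤3+s}(Γ_g·Γ_b) = 𝔡^{≤3+s}Γ_g·𝔡^{≤k_L/2}Γ_b + 𝔡^{≤k_L/2}Γ_g·𝔡^{≤3+s}Γ_b` and we use an additional `τ₁^{δ₀}`
by a standard interpolation argument, see Lemma 5.1 in [53]."  The order of `𝔡` on `(Γ_g, Γ_b)` at the top `s = k_L`: `k_L + 3`.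
[cite: GiorgiKlainermanSzeftel2024, proof of Lemma 12.2.8, p.555 L15–24; GiorgiKlainermanSzeftel2022, l.23037–23044] -/
def lem1228Consumed (ks : ℕ) : ℕ := lem1228HighTop ks + nerrInner

/-- The PRINTED order on the low factor of the same display: `𝔡^{≤k_L/2}` (ℕ-division; the parity of `k_L` is not specified in print).
[cite: GiorgiKlainermanSzeftel2024, p.555 L15–22; GiorgiKlainermanSzeftel2022, l.23039–23041] -/
def lowFactorPrinted (ks : ℕ) : ℕ := kL ks / 2

/-- What the Leibniz rule puts on the lower factor of `𝔡^{≤3+s}(Γ_g·Γ_b)` at the top `s = k_L`: `⌊(k_L + 3)/2⌋`. [folklore] -/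
def lowFactorLeibniz (ks : ℕ) : ℕ := (kL ks + 3) / 2

/-- Cor 12.1.4 = (12.3.5): the transport system "`∇₄(rΨ̲) = (q/(r q̄))𝔮̲ + r𝔡^{≤1}(Γ_g·Γ_b)`, `∇₄((q⁴/r³)A̲) = (1/r)Ψ̲ + rΓ_g·Γ_b`":
the inner order `1` of its error source.
[cite: GiorgiKlainermanSzeftel2024, Cor 12.1.4, p.548 L129–140, (12.3.5), p.563 L74–89; GiorgiKlainermanSzeftel2022, Cor `cor:systemoftransportequationsforPsibandAbfromqfb:chap12`, l.22765–22775, l.23374–23377] -/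
def sysSourceInner : ℕ := 1

/-- The transport estimate (12.3.4) of Lemma 12.3.1 applied to (12.3.5) costs ONE more derivative on the source: Prop 12.3.5's proof
("For `p ≤ −δ` we apply (12.3.4) of Lemma 12.3.1 with `Φ₁ = rΨ̲` and `Φ₂ = r^{−1}(q/q̄)𝔮̲ + r𝔡^{≤1}(Γ_g·Γ_b)`") displays on its right
`r²|𝔡^{≤2}(Γ_g·Γ_b)|²`, and again with `Φ₂ = r^{−1}Ψ̲ + rΓ_g·Γ_b`.  The increment `2 − 1`.
[cite: GiorgiKlainermanSzeftel2024, proof of Prop 12.3.5, p.564 L19–60, p.565 L6–40; GiorgiKlainermanSzeftel2022, l.23418–23426, l.23444–23450] -/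
def transportExtra : ℕ := 1

/-- The inner order displayed in Prop 12.3.5's proof: `|𝔡^{≤2}(Γ_g·Γ_b)|²`.
[cite: GiorgiKlainermanSzeftel2024, p.564 L19–60; GiorgiKlainermanSzeftel2022, l.23425–23426, l.23449–23450] -/
def prop1235Inner : ℕ := sysSourceInner + transportExtra

/-- Lemma 12.3.10 (estimates for `∇∇₄(rA̲)`, "for all `p ≤ 2 − δ`"): its proof displays the source `∫ r^{p+1}|𝔡^{≤2}(Γ_b·Γ_g)|²`
(from Lemma 12.3.8's `r^{−2}𝔡^{≤2}(Γ_b·Γ_g)`).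
[cite: GiorgiKlainermanSzeftel2024, Lemma 12.3.10 and (12.3.12), p.577 L10–p.579 L39, Lemma 12.3.8, p.570 L130–p.575 L6; GiorgiKlainermanSzeftel2022, Lemma `lemma:estimatesnabnab_4(rAb)`, l.23940–23995, l.23652–23660] -/
def lem12310Inner : ℕ := 2

/-- Lemma 12.3.9 (estimates for `∇A̲`, "for all `p ≤ 2 − δ`"): (12.3.11) "`∫_{𝓜(τ₁,τ₂)} r^{p−1}|𝔡^{≤1}(Γ_b·Γ_b)|² ≲ ε⁴τ₁^{−2−2δ_dec}`
which holds true for `p ≤ 2 − δ`" ([J] p.576 L28 / L36 / L67 prints this integrand as `Γ_b·Γ_b` throughout; [v1] prints it once as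
`𝔡^{≤1}(Γ_b·Γ_g)`, l.23899, against `Γ_b·Γ_b` at l.23888 / l.23896 — a [v1] inconsistency corrected in [J]).
[cite: GiorgiKlainermanSzeftel2024, Lemma 12.3.9, p.575 L10–30, (12.3.11), p.576 L5–73; GiorgiKlainermanSzeftel2022, Lemma `lemma:EstimatesfornabAb`, l.23843–23856, `Estimate:nabAb-error`, l.23890–23914] -/
def lem1239Inner : ℕ := 1

/-- §12.3.6 item 2, the commuted systems at level `s = 1`: "`∇₄(𝓛̸_T(rΨ̲)) = (q/(r q̄))𝓛̸_T𝔮̲ + r𝔡^{≤2}(Γ_g·Γ_b)`", "`∇₄(q̄ 𝒟̄·(rΨ̲)) =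
(q/(r q̄))𝔡̸^{≤1}𝔮̲ + r𝔡^{≤2}(Γ_g·Γ_b)`" (and `r𝔡^{≤1}(Γ_g·Γ_b)` in the `A̲`-equations): one commutation raises the source of (12.3.5)
from `𝔡^{≤1}` to `𝔡^{≤2}` BEFORE the transport estimate is applied ("Using the iteration assumption for these commuted systems").
[cite: GiorgiKlainermanSzeftel2024, §12.3.6 item 2–3, p.581 L20–p.582 L9; GiorgiKlainermanSzeftel2022, l.24097–24137] -/
def commutedSourceInner : ℕ := 2

/-- The order of `𝔡` on `(Γ_g, Γ_b)` consumed by the transport side (Prop 12.2.9 via §12.3) at its top `s = k_L`: the source at level `s`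
holds `𝔡^{≤s+1}(Γ_g·Γ_b)` (displayed for `s = 0, 1`) and the transport estimate adds `transportExtra = 1` — `k_L + 2`.  DISPLAYED as `2`
at `s = 0`; the linear continuation in `s` is our reading of "Thus, by iteration" (a reading of the cited displays, not a printed integer).
[cite: GiorgiKlainermanSzeftel2024, p.564 L19–60, p.581 L20–p.582 L9; GiorgiKlainermanSzeftel2022, l.23418–23426, l.24097–24137] [folklore] -/
def prop1229Consumed (ks : ℕ) : ℕ := prop1229Top ks + prop1235Inner

/-- Unfolding lemma. [folklore] -/
@[simp] lemma nerrInner_def : nerrInner = 3 := rfl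
/-- Unfolding lemma. [folklore] -/
@[simp] lemma ntInner_def : ntInner = 2 := rfl
/-- Unfolding lemma. [folklore] -/
@[simp] lemma lem1228Consumed_def (ks : ℕ) : lem1228Consumed ks = lem1228HighTop ks + nerrInner := rfl
/-- Unfolding lemma. [folklore] -/
@[simp] lemma lowFactorPrinted_def (ks : ℕ) : lowFactorPrinted ks = kL ks / 2 := rfl
/-- Unfolding lemma. [folklore] -/
@[simp] lemma lowFactorLeibniz_def (ks : ℕ) : lowFactorLeibniz ks = (kL ks + 3) / 2 := rfl
/-- Unfolding lemma. [folklore] -/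
@[simp] lemma sysSourceInner_def : sysSourceInner = 1 := rfl
/-- Unfolding lemma. [folklore] -/
@[simp] lemma transportExtra_def : transportExtra = 1 := rfl
/-- Unfolding lemma. [folklore] -/
@[simp] lemma prop1235Inner_def : prop1235Inner = sysSourceInner + transportExtra := rfl
/-- Unfolding lemma. [folklore] -/
@[simp] lemma lem12310Inner_def : lem12310Inner = 2 := rfl
/-- Unfolding lemma. [folklore] -/
@[simp] lemma lem1239Inner_def : lem1239Inner = 1 := rfl
/-- Unfolding lemma. [folklore] -/
@[simp] lemma commutedSourceInner_def : commutedSourceInner = 2 := rfl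
/-- Unfolding lemma. [folklore] -/
@[simp] lemma prop1229Consumed_def (ks : ℕ) : prop1229Consumed ks = prop1229Top ks + prop1235Inner := rfl

/-- (K-A) Lemma 12.2.8 at its top `s = k_L` consumes (12.1.1) at order `k_L + 3`, three above the STATED range `k ≤ k_L` of the
hypotheses; the principal part `Ñ_err` (inner order `2`, kept on the right of (12.2.2) and estimated only in §12.4.2) is not consumed here.
[cite: GiorgiKlainermanSzeftel2024, (12.1.1), p.544 L14–25, p.555 L15–24; GiorgiKlainermanSzeftel2022, l.22595–22603, l.23037–23044] -/
theorem lem1228_overshoot (ks : ℕ) :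
    lem1228Consumed ks = hyp12Top ks + 3 ∧ hyp12Top ks < lem1228Consumed ks ∧ lem1228Consumed ks - hyp12Top ks = nerrInner ∧
    ntInner < nerrInner := by
  dsimp only [lem1228Consumed_def, lem1228HighTop_def, hyp12Top_def, nerrInner_def, ntInner_def, kL_def]; omega

/-- (K-A, the printed device) the overshoot `3` is paid, in print, by "a standard interpolation argument, see Lemma 5.1 in [53]"; the cited
lemma's printed loss is `k_loss = 33` (`FullRWInteriorLedger.schwKloss`), and `3 ≤ 33`.  Integers only: whether [53] Lemma 5.1 (a
Schwarzschild-setting interpolation between decaying low norms and bounded high norms) applies verbatim is not asserted.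
[cite: GiorgiKlainermanSzeftel2024, p.555 L23–24; GiorgiKlainermanSzeftel2022, l.23044 ("Lemma 5.1 in \cite{KS}"); KlainermanSzeftel2020, Lemma 5.1] -/
theorem interp_pointer (ks : ℕ) : lem1228Consumed ks - hyp12Top ks ≤ schwKloss ∧ schwKloss - (lem1228Consumed ks - hyp12Top ks) = 30 := by
  dsimp only [lem1228Consumed_def, lem1228HighTop_def, hyp12Top_def, nerrInner_def, schwKloss_def, kL_def]; omega

/-- (K-A, print precision) Leibniz puts up to `⌊(k_L+3)/2⌋` derivatives on the lower factor, i.e. `k_L/2 + 1` (`k_L` even) or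
`⌊k_L/2⌋ + 2` (`k_L` odd) — one or two MORE than the printed `𝔡^{≤k_L/2}`; either way the lower factor stays inside the stated range
`k ≤ k_L` (indeed `≤ k_L − 57`), so the schematic display under-prints a harmless index. [folklore] -/
theorem low_factor_datum (ks : ℕ) :
    lowFactorLeibniz ks = lowFactorPrinted ks + 1 + kL ks % 2 ∧ lowFactorPrinted ks < lowFactorLeibniz ks ∧
    lowFactorLeibniz ks ≤ lowFactorPrinted ks + 2 ∧ lowFactorLeibniz ks + 57 ≤ hyp12Top ks := by
  dsimp only [lowFactorLeibniz_def, lowFactorPrinted_def, hyp12Top_def, kL_def]; omega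

/-- (K-B) the three displayed `2`s of §12.3 agree: (12.3.5)'s source order `1` plus the transport estimate's `1` = Prop 12.3.5's
displayed `2` = Lemma 12.3.10's `2` = the commuted systems' `2`; Lemma 12.3.9's `Γ_b·Γ_b` term costs `1`. [folklore] -/
theorem sec123_inner_orders :
    prop1235Inner = 2 ∧ prop1235Inner = lem12310Inner ∧ prop1235Inner = commutedSourceInner ∧ lem1239Inner < prop1235Inner ∧
    commutedSourceInner = sysSourceInner + 1 := by
  dsimp only [prop1235Inner_def, sysSourceInner_def, transportExtra_def, lem12310Inner_def, commutedSourceInner_def, lem1239Inner_def]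
  omega

/-- (K-B) the transport side at its top consumes order `k_L + 2`, two above the stated hypotheses and one below Lemma 12.2.8's `k_L + 3`.
[folklore] -/
theorem prop1229_overshoot (ks : ℕ) :
    prop1229Consumed ks = hyp12Top ks + 2 ∧ hyp12Top ks < prop1229Consumed ks ∧ prop1229Consumed ks + 1 = lem1228Consumed ks := by
  dsimp only [prop1229Consumed_def, prop1229Top_def, prop1235Inner_def, sysSourceInner_def, transportExtra_def, hyp12Top_def,
    lem1228Consumed_def, lem1228HighTop_def, nerrInner_def, kL_def]
  omega

/-- (K-B) the literal total of §12.1–12.3: the larger of the two consumed orders is Lemma 12.2.8's `k_L + 3`. [folklore] -/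
theorem ch12_literal_consumption (ks : ℕ) :
    max (lem1228Consumed ks) (prop1229Consumed ks) = kL ks + 3 ∧ max (lem1228Consumed ks) (prop1229Consumed ks) = lem1228Consumed ks := by
  dsimp only [prop1229Consumed_def, prop1229Top_def, prop1235Inner_def, sysSourceInner_def, transportExtra_def,
    lem1228Consumed_def, lem1228HighTop_def, nerrInner_def, kL_def]
  omega

/-- (K-B vs J-A/J-B) ch. 12's literal consumption `k_L + 3` equals ch. 11's Prop 11.6.4 consumption and is ONE LESS than ch. 11's literal
total `k_L + 4` (`FullRWInteriorLedger.prop1164Consumed`, `hypConsumedLiteral`): ch. 12 has no analogue of the `+1` of Thms 11.6.1/11.6.2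
over Prop 11.6.4 — Thm 12.2.4, Prop 12.2.7, Prop 12.2.9 and the hypotheses all print the one top `k_L`. [folklore] -/
theorem ch12_vs_ch11 (ks : ℕ) :
    lem1228Consumed ks = prop1164Consumed ks ∧ lem1228Consumed ks + 1 = hypConsumedLiteral ks ∧
    thm1224Top ks = prop1227Top ks ∧ prop1227Top ks = prop1229Top ks ∧ prop1229Top ks = hyp12Top ks := by
  dsimp only [lem1228Consumed_def, lem1228HighTop_def, nerrInner_def, prop1164Consumed_def, prop1164Top_def, iNormExtra_def,
    ngInner_def, hypConsumedLiteral_def, thm1161Needs_def, thm1161Top_def, rhs514Extra_def, thm1224Top_def, prop1227Top_def,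
    prop1229Top_def, hyp12Top_def, kL_def]
  omega

/-- (K-C) the USE made by §12.4: Step 1 of the proof of Prop 12.4.6 invokes Cor 12.2.5 "for `s ≤ k_L`" (`TheoremM1M2Ledger.t1224Top`),
i.e. AT the corollary's stated top — so, unlike §11.7.3 (`FullRWInteriorLedger.sec1173_nonbinding`: uses at `k_L − 2`, `k_L − 3`), the use
does not lower the consumed order below `k_L + 3`.
[cite: GiorgiKlainermanSzeftel2024, Step 1 (12.4.10), p.587 L90–97, Cor 12.2.5, p.552 L18–21; GiorgiKlainermanSzeftel2022, l.24375] -/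
theorem sec124_use_at_top (ks : ℕ) :
    t1224Top ks = cor1225Top ks ∧ cor1225Top ks = thm1224Top ks ∧ t1224Top ks + nerrInner = lem1228Consumed ks ∧
    s1 ks < t1224Top ks := by
  dsimp only [t1224Top_def, cor1225Top_def, thm1224Top_def, lem1228Consumed_def, lem1228HighTop_def, nerrInner_def, s1_def, kL_def]
  omega

/-- (K-C) THE DATUM (integers only).  Every order consumed in §12.1–12.3 is covered by the printed [KS] supply of the global frame
(`FullRWInteriorLedger.ksGlobalTop ks = k_small + 125`, [KS] HAL Prop 3.6.9) with margin `2` (Lemma 12.2.8) resp. `3` (transport side),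
and by the primed frame's `k_small + 129` with margin `6`.  Nothing about which frame [J] ch. 12 works in beyond Remark 12.4.1
("the global frame … constructed in section 3.6 of [56]") is asserted.
[cite: GiorgiKlainermanSzeftel2024, Remark 12.4.1, p.582 L26–30, p.555 L15–24; KlainermanSzeftel2023, Prop 3.6.9 (HAL), Prop 4.4.3] -/
theorem ks_supply_covers_ch12 (ks : ℕ) :
    lem1228Consumed ks ≤ ksGlobalTop ks ∧ ksGlobalTop ks - lem1228Consumed ks = 2 ∧
    prop1229Consumed ks ≤ ksGlobalTop ks ∧ ksGlobalTop ks - prop1229Consumed ks = 3 ∧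
    ksPrimedTop ks - lem1228Consumed ks = 6 ∧ ksGlobalTop ks = kL ks + 5 := by
  dsimp only [lem1228Consumed_def, lem1228HighTop_def, nerrInner_def, prop1229Consumed_def, prop1229Top_def, prop1235Inner_def,
    sysSourceInner_def, transportExtra_def, ksGlobalTop_def, ksPrimedTop_def, kL_def]
  omega

/-! ## §2 The displayed algebra of complex scalars: (12.1.4), Lemma 12.1.2, Cor 12.1.4, Lemma 12.3.7, and [J] Lemma 11.1.3

Dictionary (the only one used): `x = tr χ ∈ ℝ`, `x ≠ 0`; `y = ⁽ᵃ⁾tr χ ∈ ℝ`; `tr X = tr χ − i ⁽ᵃ⁾tr χ` (Def. of `tr X` recalled in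
[J] (12.1.4)'s context: `Re(tr X) = tr χ`, `|tr X|² = tr χ² + ⁽ᵃ⁾tr χ²`).  For ch. 11 the same letters stand for `tr χ̲`, `⁽ᵃ⁾tr χ̲`,
`tr X̲`.  The QUOTED differential rule "`∇₄ tr X + ½(tr X)² = r^{−2}𝔡^{≤1}Γ_g`" enters only through the printed right-hand side of
the display it is used in (the `r^{−2}𝔡^{≤1}Γ_g` remainders are dropped from both sides, as in print). -/

/-- `tr X = tr χ − i ⁽ᵃ⁾tr χ` as a complex number, `x = tr χ`, `y = ⁽ᵃ⁾tr χ`.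
[cite: GiorgiKlainermanSzeftel2024, proof of Lemma 12.1.2, p.547 L5–20 ("`4 tr X − 2|tr X|²/tr χ = 4tr χ − 4i⁽ᵃ⁾tr χ − 2(tr χ² + ⁽ᵃ⁾tr χ²)/tr χ`"); GiorgiKlainermanSzeftel2022, l.22712–22716] -/
noncomputable def trX (x y : ℝ) : ℂ := (x : ℂ) - Complex.I * (y : ℂ)

/-- `conj(tr X) = tr χ + i ⁽ᵃ⁾tr χ`. [folklore] -/
noncomputable def trXb (x y : ℝ) : ℂ := (x : ℂ) + Complex.I * (y : ℂ)

/-- `|tr X|² = tr χ² + ⁽ᵃ⁾tr χ²` (real). [folklore] -/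
def nsq (x y : ℝ) : ℝ := x ^ 2 + y ^ 2

/-- (12.1.4) = (11.1.5): "`C̲₁ = 2tr χ − 2 ⁽ᵃ⁾tr χ²/tr χ − 4i ⁽ᵃ⁾tr χ`".
[cite: GiorgiKlainermanSzeftel2024, (12.1.4), p.545 L42–55, (11.1.5), p.478 L14–23; GiorgiKlainermanSzeftel2022, `eq:defintionofCb1andCb2fordefintionqfb:chap12`, l.22642–22648, `eq:definition-qf-again`, l.20283–20289] -/
noncomputable def Cb1 (x y : ℝ) : ℂ := 2 * (x : ℂ) - 2 * (y : ℂ) ^ 2 / (x : ℂ) - 4 * Complex.I * (y : ℂ)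

/-- (12.1.4) = (11.1.5): "`C̲₂ = ½tr χ² − 4 ⁽ᵃ⁾tr χ² + (3/2) ⁽ᵃ⁾tr χ⁴/tr χ² + i(−2tr χ ⁽ᵃ⁾tr χ + 4 ⁽ᵃ⁾tr χ³/tr χ)`".
[cite: GiorgiKlainermanSzeftel2024, (12.1.4), p.545 L42–55, (11.1.5), p.478 L14–23; GiorgiKlainermanSzeftel2022, l.22642–22648, l.20283–20289] -/
noncomputable def Cb2 (x y : ℝ) : ℂ :=
  (1/2 : ℂ) * (x : ℂ) ^ 2 - 4 * (y : ℂ) ^ 2 + (3/2 : ℂ) * (y : ℂ) ^ 4 / (x : ℂ) ^ 2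
    + Complex.I * (-2 * (x : ℂ) * (y : ℂ) + 4 * (y : ℂ) ^ 3 / (x : ℂ))

/-- Unfolding lemma. [folklore] -/
@[simp] lemma nsq_def (x y : ℝ) : nsq x y = x ^ 2 + y ^ 2 := rfl

/-- `|tr X|² = tr χ² + ⁽ᵃ⁾tr χ²`. [folklore] -/
theorem normSq_trX (x y : ℝ) : Complex.normSq (trX x y) = nsq x y := by
  simp [trX, Complex.normSq_apply]; ring

/-- `conj(tr X) = tr χ + i ⁽ᵃ⁾tr χ`. [folklore] -/
theorem conj_trX (x y : ℝ) : (starRingEnd ℂ) (trX x y) = trXb x y := by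
  apply Complex.ext <;> simp [trX, trXb]

/-- `Re(tr X) = tr χ`, `Im(tr X) = −⁽ᵃ⁾tr χ`. [folklore] -/
theorem re_im_trX (x y : ℝ) : (trX x y).re = x ∧ (trX x y).im = -y := by
  constructor <;> simp [trX]

/-- `Re((tr X)²) = tr χ² − ⁽ᵃ⁾tr χ²` (the "`Re(−½(tr X)²)`" of [J] p.547 L67–p.548 L4 is `−½` of this). [folklore] -/
theorem re_sq_trX (x y : ℝ) : ((trX x y) ^ 2).re = x ^ 2 - y ^ 2 := by
  simp [trX, pow_two, Complex.mul_re]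

/-- Proof of Lemma 12.1.2, first display after the expansion: "`4 tr X − 2|tr X|²/tr χ = 4tr χ − 4i ⁽ᵃ⁾tr χ − 2(tr χ² + ⁽ᵃ⁾tr χ²)/tr χ =
2tr χ − 2 ⁽ᵃ⁾tr χ²/tr χ − 4i ⁽ᵃ⁾tr χ = C̲₁`".  Certified as an identity in `ℂ` for `tr χ ≠ 0`.
[cite: GiorgiKlainermanSzeftel2024, p.547 L5–22; GiorgiKlainermanSzeftel2022, l.22712–22718] -/
theorem lem1212_Cb1 (x y : ℝ) (hx : x ≠ 0) : 4 * trX x y - 2 * ((nsq x y : ℝ) : ℂ) / (x : ℂ) = Cb1 x y := by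
  have hx' : (x : ℂ) ≠ 0 := by exact_mod_cast hx
  dsimp only [trX, Cb1, nsq_def]
  push_cast
  field_simp
  ring

/-- Proof of Lemma 12.1.2, the `∇₄` display: under the quoted rule `∇₄ tr X = −½(tr X)² (+ r^{−2}𝔡^{≤1}Γ_g)` (so `∇₄ conj(tr X) =
−½ conj(tr X)²`, `∇₄ tr χ = Re(−½(tr X)²)`), "`∇₄(2 tr X − (3/2)|tr X|²/tr χ) = −(tr X)² − (3/2)(−½(tr X)² conj(tr X) + tr X·(−½conj(tr X)²))/tr χ
+ (3/2)|tr X|² Re(−½(tr X)²)/tr χ² = −(tr X)² + (3/2)|tr X|² − (3/4)|tr X|²(tr χ² − ⁽ᵃ⁾tr χ²)/tr χ² = −¼tr χ² + (5/2) ⁽ᵃ⁾tr χ² +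
(3/4) ⁽ᵃ⁾tr χ⁴/tr χ² + 2i tr χ ⁽ᵃ⁾tr χ`" (remainders `r^{−2}𝔡^{≤1}Γ_g` dropped on both sides as in print).  Certified: first line = third
line and second line = third line, with `Re(−½(tr X)²) = −½(tr χ² − ⁽ᵃ⁾tr χ²)` (`re_sq_trX`).  The Leibniz/chain rule producing the first
line from the quoted rule is NOT formalised.
[cite: GiorgiKlainermanSzeftel2024, p.547 L59–p.548 L4; GiorgiKlainermanSzeftel2022, l.22725–22738] -/
theorem lem1212_nabla4 (x y : ℝ) (hx : x ≠ 0) :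
    (-(trX x y) ^ 2 - (3/2 : ℂ) * ((-(1/2 : ℂ)) * (trX x y) ^ 2 * trXb x y + trX x y * ((-(1/2 : ℂ)) * (trXb x y) ^ 2)) / (x : ℂ)
        + (3/2 : ℂ) * ((nsq x y : ℝ) : ℂ) * ((-(1/2 : ℂ)) * (((x ^ 2 - y ^ 2 : ℝ)) : ℂ)) / (x : ℂ) ^ 2
      = -(1/4 : ℂ) * (x : ℂ) ^ 2 + (5/2 : ℂ) * (y : ℂ) ^ 2 + (3/4 : ℂ) * (y : ℂ) ^ 4 / (x : ℂ) ^ 2 + 2 * Complex.I * (x : ℂ) * (y : ℂ))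
    ∧ (-(trX x y) ^ 2 + (3/2 : ℂ) * ((nsq x y : ℝ) : ℂ) - (3/4 : ℂ) * ((nsq x y : ℝ) : ℂ) * (((x ^ 2 - y ^ 2 : ℝ)) : ℂ) / (x : ℂ) ^ 2
      = -(1/4 : ℂ) * (x : ℂ) ^ 2 + (5/2 : ℂ) * (y : ℂ) ^ 2 + (3/4 : ℂ) * (y : ℂ) ^ 4 / (x : ℂ) ^ 2 + 2 * Complex.I * (x : ℂ) * (y : ℂ)) := by
  have hx' : (x : ℂ) ≠ 0 := by exact_mod_cast hx
  constructor
  · simp only [trX, trXb, nsq_def]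
    push_cast
    field_simp
    ring_nf
    simp only [Complex.I_sq]
    ring
  · simp only [trX, nsq_def]
    push_cast
    field_simp
    ring_nf
    simp only [Complex.I_sq]
    ring

/-- Proof of Lemma 12.1.2, the two factors written out: "`(2 tr X − ½|tr X|²/tr χ)(2 tr X − (3/2)|tr X|²/tr χ) =
((3/2)tr χ − ½ ⁽ᵃ⁾tr χ²/tr χ − 2i ⁽ᵃ⁾tr χ)(½tr χ − (3/2) ⁽ᵃ⁾tr χ²/tr χ − 2i ⁽ᵃ⁾tr χ)`" — each factor separately.
[cite: GiorgiKlainermanSzeftel2024, p.548 L5–30; GiorgiKlainermanSzeftel2022, l.22739–22743] -/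
theorem lem1212_factors (x y : ℝ) (hx : x ≠ 0) :
    2 * trX x y - (1/2 : ℂ) * ((nsq x y : ℝ) : ℂ) / (x : ℂ) = (3/2 : ℂ) * (x : ℂ) - (1/2 : ℂ) * (y : ℂ) ^ 2 / (x : ℂ) - 2 * Complex.I * (y : ℂ) ∧
    2 * trX x y - (3/2 : ℂ) * ((nsq x y : ℝ) : ℂ) / (x : ℂ) = (1/2 : ℂ) * (x : ℂ) - (3/2 : ℂ) * (y : ℂ) ^ 2 / (x : ℂ) - 2 * Complex.I * (y : ℂ) := by
  have hx' : (x : ℂ) ≠ 0 := by exact_mod_cast hx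
  constructor <;>
  · simp only [trX, nsq_def]
    push_cast
    field_simp
    ring

/-- Proof of Lemma 12.1.2, the `C̲₂` display: "`∇₄(2 tr X − (3/2)|tr X|²/tr χ) + (2 tr X − ½|tr X|²/tr χ)(2 tr X − (3/2)|tr X|²/tr χ) =
−¼tr χ² + (5/2) ⁽ᵃ⁾tr χ² + (3/4) ⁽ᵃ⁾tr χ⁴/tr χ² + 2i tr χ ⁽ᵃ⁾tr χ + ((3/2)tr χ − ½ ⁽ᵃ⁾tr χ²/tr χ − 2i ⁽ᵃ⁾tr χ)(½tr χ − (3/2) ⁽ᵃ⁾tr χ²/tr χ − 2i ⁽ᵃ⁾tr χ)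
= ½tr χ² − 4 ⁽ᵃ⁾tr χ² + (3/2) ⁽ᵃ⁾tr χ⁴/tr χ² + i(−2tr χ ⁽ᵃ⁾tr χ + 4 ⁽ᵃ⁾tr χ³/tr χ) = C̲₂`" (remainders dropped as in print).  So the printed
`C̲₁`, `C̲₂` of (12.1.4) are exactly what the displayed factorisation produces.
[cite: GiorgiKlainermanSzeftel2024, p.548 L5–70; GiorgiKlainermanSzeftel2022, l.22739–22747] -/
theorem lem1212_Cb2 (x y : ℝ) (hx : x ≠ 0) :
    (-(1/4 : ℂ) * (x : ℂ) ^ 2 + (5/2 : ℂ) * (y : ℂ) ^ 2 + (3/4 : ℂ) * (y : ℂ) ^ 4 / (x : ℂ) ^ 2 + 2 * Complex.I * (x : ℂ) * (y : ℂ))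
      + ((3/2 : ℂ) * (x : ℂ) - (1/2 : ℂ) * (y : ℂ) ^ 2 / (x : ℂ) - 2 * Complex.I * (y : ℂ))
        * ((1/2 : ℂ) * (x : ℂ) - (3/2 : ℂ) * (y : ℂ) ^ 2 / (x : ℂ) - 2 * Complex.I * (y : ℂ)) = Cb2 x y := by
  have hx' : (x : ℂ) ≠ 0 := by exact_mod_cast hx
  simp only [Cb2]
  field_simp
  ring_nf
  simp only [Complex.I_sq]
  ring

/-- The whole of Lemma 12.1.2's scalar algebra in one line: with `∇₄` evaluated as displayed, the first-order coefficient is `C̲₁` and the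
zeroth-order coefficient is `C̲₂` — i.e. (12.1.4)'s `𝔮̲ = q̄q³(∇₄∇₄A̲ + C̲₁∇₄A̲ + C̲₂A̲)` matches the product
`(∇₄ + 2tr X − |tr X|²/(2tr χ))(∇₄ + 2tr X − 3|tr X|²/(2tr χ))` modulo the dropped remainders (composition of the three displays).
[cite: GiorgiKlainermanSzeftel2024, Lemma 12.1.2, p.546 L66–p.548 L116; GiorgiKlainermanSzeftel2022, l.22697–22755] [folklore] -/
theorem lem1212_coefficients (x y : ℝ) (hx : x ≠ 0) :
    4 * trX x y - 2 * ((nsq x y : ℝ) : ℂ) / (x : ℂ) = Cb1 x y ∧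
    (-(trX x y) ^ 2 + (3/2 : ℂ) * ((nsq x y : ℝ) : ℂ) - (3/4 : ℂ) * ((nsq x y : ℝ) : ℂ) * (((x ^ 2 - y ^ 2 : ℝ)) : ℂ) / (x : ℂ) ^ 2)
      + (2 * trX x y - (1/2 : ℂ) * ((nsq x y : ℝ) : ℂ) / (x : ℂ)) * (2 * trX x y - (3/2 : ℂ) * ((nsq x y : ℝ) : ℂ) / (x : ℂ)) = Cb2 x y := by
  refine ⟨lem1212_Cb1 x y hx, ?_⟩
  rw [(lem1212_nabla4 x y hx).2, (lem1212_factors x y hx).1, (lem1212_factors x y hx).2]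
  exact lem1212_Cb2 x y hx

/-- Proof of Cor 12.1.4, the rewriting of `Ψ̲`'s coefficient: "`∇₄ + 2tr X − 3|tr X|²/(2tr χ) = ∇₄ + ½tr X + 3(tr χ tr X − |tr X|²)/(2tr χ)`",
followed by "`= O(r²)(∇₄ + ½tr X)A̲ + O(r²) ⁽ᵃ⁾tr χ A̲`": certified are the identity and the evaluation `3(tr χ tr X − |tr X|²)/(2tr χ) =
−(3/2)(⁽ᵃ⁾tr χ²/tr χ + i ⁽ᵃ⁾tr χ)`, which vanishes when `⁽ᵃ⁾tr χ = 0`.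
[cite: GiorgiKlainermanSzeftel2024, proof of Cor 12.1.4, p.549 L15–43; GiorgiKlainermanSzeftel2022, l.22773–22779] -/
theorem cor1214_rewrite (x y : ℝ) (hx : x ≠ 0) :
    2 * trX x y - 3 * ((nsq x y : ℝ) : ℂ) / (2 * (x : ℂ)) = (1/2 : ℂ) * trX x y + 3 * ((x : ℂ) * trX x y - ((nsq x y : ℝ) : ℂ)) / (2 * (x : ℂ)) ∧
    3 * ((x : ℂ) * trX x y - ((nsq x y : ℝ) : ℂ)) / (2 * (x : ℂ)) = -(3/2 : ℂ) * ((y : ℂ) ^ 2 / (x : ℂ) + Complex.I * (y : ℂ)) ∧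
    (y = 0 → 3 * ((x : ℂ) * trX x y - ((nsq x y : ℝ) : ℂ)) / (2 * (x : ℂ)) = 0) := by
  have hx' : (x : ℂ) ≠ 0 := by exact_mod_cast hx
  have h2 : 3 * ((x : ℂ) * trX x y - ((nsq x y : ℝ) : ℂ)) / (2 * (x : ℂ)) = -(3/2 : ℂ) * ((y : ℂ) ^ 2 / (x : ℂ) + Complex.I * (y : ℂ)) := by
    simp only [trX, nsq_def]; push_cast; field_simp; ring
  refine ⟨?_, h2, ?_⟩
  · simp only [trX, nsq_def]; push_cast; field_simp; ring
  · intro hy; rw [h2, hy]; push_cast; simp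

/-- Proof of Cor 12.1.4, the `e₄`-weights: with the quoted "`e₄(q)/q = ½tr X + Γ_g`, `e₄(r)/r = ½|tr X|²/tr χ + Γ_g`", the displayed
coefficients "`∇₄ + 4e₄(q)/q − e₄(r)/r = ∇₄ + 2tr X − |tr X|²/(2tr χ) + Γ_g`" and "`4e₄(q)/q − 3e₄(r)/r`" ([J]; [v1] l.22815 prints
`3e₃(r)/r`) "`= 2tr X − 3|tr X|²/(2tr χ) + Γ_g`" (the `Γ_g` dropped on both sides).
[cite: GiorgiKlainermanSzeftel2024, p.549 L70–100, p.550 L15–30; GiorgiKlainermanSzeftel2022, l.22786–22800, l.22813–22819] -/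
theorem cor1214_e4_weights (x y : ℝ) :
    4 * ((1/2 : ℂ) * trX x y) - (1/2 : ℂ) * ((nsq x y : ℝ) : ℂ) / (x : ℂ) = 2 * trX x y - ((nsq x y : ℝ) : ℂ) / (2 * (x : ℂ)) ∧
    4 * ((1/2 : ℂ) * trX x y) - 3 * ((1/2 : ℂ) * ((nsq x y : ℝ) : ℂ) / (x : ℂ)) = 2 * trX x y - 3 * ((nsq x y : ℝ) : ℂ) / (2 * (x : ℂ)) := by
  constructor <;> ring

/-- Proof of Lemma 12.3.7, the expansion: "`(∇₄ + (3/2)tr X + h)(∇₄A̲ + ½tr X A̲) = ∇₄²A̲ + (2tr X + h)∇₄A̲ + ((3/4)(tr X)² + ½tr X h +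
½∇₄(tr X))A̲ = … + (½(tr X)² + ½tr X h)A̲ + r^{−2}𝔡^{≤1}(Γ_g·Γ_b)`" with `∇₄ tr X = −½(tr X)² + …`: the scalar identities
`(3/2) + ½ = 2` and `(3/4)X² + ½(−½X²) = ½X²`.
[cite: GiorgiKlainermanSzeftel2024, proof of Lemma 12.3.7, p.569 L1–40; GiorgiKlainermanSzeftel2022, l.23594–23601] -/
theorem lem1237_expand (X h : ℂ) :
    (3/2 : ℂ) * X + (1/2 : ℂ) * X + h = 2 * X + h ∧ (3/4 : ℂ) * X ^ 2 + (1/2 : ℂ) * X * h + (1/2 : ℂ) * (-(1/2 : ℂ) * X ^ 2)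
      = (1/2 : ℂ) * X ^ 2 + (1/2 : ℂ) * X * h := by
  constructor <;> ring

/-- Proof of Lemma 12.3.7, the choice of `h`: "We choose `h := C̲₁ − 2tr X` so that `h = 2tr χ − 2 ⁽ᵃ⁾tr χ²/tr χ − 4i ⁽ᵃ⁾tr χ − 2tr χ +
2i ⁽ᵃ⁾tr χ = −2 ⁽ᵃ⁾tr χ²/tr χ − 2i ⁽ᵃ⁾tr χ`" — whence the statement's operator `∇₄ + (3/2)tr X − 2 ⁽ᵃ⁾tr χ²/tr χ − 2i ⁽ᵃ⁾tr χ`.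
[cite: GiorgiKlainermanSzeftel2024, Lemma 12.3.7, p.568 L138–p.569 L5, p.569 L77–95; GiorgiKlainermanSzeftel2022, l.23585–23591, l.23606–23613] -/
theorem lem1237_h (x y : ℝ) : Cb1 x y - 2 * trX x y = -2 * (y : ℂ) ^ 2 / (x : ℂ) - 2 * Complex.I * (y : ℂ) := by
  simp only [Cb1, trX]; ring

/-- Proof of Lemma 12.3.7, the remainder: "`C̲₂ − (½(tr X)² + ½tr X(−2 ⁽ᵃ⁾tr χ²/tr χ − 2i ⁽ᵃ⁾tr χ)) = −(3/2) ⁽ᵃ⁾tr χ² + (3/2) ⁽ᵃ⁾tr χ⁴/tr χ²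
+ 3i ⁽ᵃ⁾tr χ³/tr χ` where both the `tr χ²` in the real part and the `tr χ ⁽ᵃ⁾tr χ` terms in the imaginary part cancel", the remainder being
then "`O(a²r^{−4}) + r^{−2}Γ_g`": certified are the identity and that the remainder vanishes identically when `⁽ᵃ⁾tr χ = 0`.
[cite: GiorgiKlainermanSzeftel2024, p.569 L100–p.570 L60; GiorgiKlainermanSzeftel2022, l.23620–23640] -/
theorem lem1237_remainder (x y : ℝ) (hx : x ≠ 0) :
    Cb2 x y - ((1/2 : ℂ) * (trX x y) ^ 2 + (1/2 : ℂ) * trX x y * (-2 * (y : ℂ) ^ 2 / (x : ℂ) - 2 * Complex.I * (y : ℂ)))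
      = -(3/2 : ℂ) * (y : ℂ) ^ 2 + (3/2 : ℂ) * (y : ℂ) ^ 4 / (x : ℂ) ^ 2 + 3 * Complex.I * (y : ℂ) ^ 3 / (x : ℂ) ∧
    (y = 0 → Cb2 x y - ((1/2 : ℂ) * (trX x y) ^ 2 + (1/2 : ℂ) * trX x y * (-2 * (y : ℂ) ^ 2 / (x : ℂ) - 2 * Complex.I * (y : ℂ))) = 0) := by
  have hx' : (x : ℂ) ≠ 0 := by exact_mod_cast hx
  have h1 : Cb2 x y - ((1/2 : ℂ) * (trX x y) ^ 2 + (1/2 : ℂ) * trX x y * (-2 * (y : ℂ) ^ 2 / (x : ℂ) - 2 * Complex.I * (y : ℂ)))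
      = -(3/2 : ℂ) * (y : ℂ) ^ 2 + (3/2 : ℂ) * (y : ℂ) ^ 4 / (x : ℂ) ^ 2 + 3 * Complex.I * (y : ℂ) ^ 3 / (x : ℂ) := by
    simp only [Cb2, trX]
    field_simp
    ring_nf
    simp only [Complex.I_sq]
    ring
  refine ⟨h1, ?_⟩
  intro hy; rw [h1, hy]; push_cast; simp

/-- [J] Lemma 11.1.3 (factorisation of `𝔮`, (11.1.12)), proof: with `tr X̲ = tr χ̲ − i ⁽ᵃ⁾tr χ̲` (same letters `x, y`), the leading parts
"`C̃₁ = 2tr X̲ − 2conj(tr X̲) + ((tr X̲)² + conj(tr X̲)²)/Re(tr X̲) + 𝔡^{≤1}Γ_b = −4i ⁽ᵃ⁾tr χ̲ + (2/tr χ̲)(tr χ̲² − ⁽ᵃ⁾tr χ̲²) + … = C₁ + 𝔡^{≤1}Γ_b`"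
— the same formula (11.1.5) = (12.1.4).  Certified with the `𝔡^{≤1}Γ_b` dropped on both sides.
[cite: GiorgiKlainermanSzeftel2024, Lemma 11.1.3, p.479 L19–30, proof, p.480 L90–p.481 L19; GiorgiKlainermanSzeftel2022, Lemma `lemma:factorizationofqfusefulfortransportequations`, l.20350–20362, l.20406–20411] -/
theorem lem1113_C1tilde (x y : ℝ) (hx : x ≠ 0) :
    2 * trX x y - 2 * trXb x y + ((trX x y) ^ 2 + (trXb x y) ^ 2) / (x : ℂ) = Cb1 x y := by
  have hx' : (x : ℂ) ≠ 0 := by exact_mod_cast hx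
  simp only [trX, trXb, Cb1]
  field_simp
  ring_nf
  simp only [Complex.I_sq]
  ring

/-- [J] Lemma 11.1.3, proof, the zeroth-order leading part: "`C̃₂ = 2∇₃(F₂) + ½(−(tr X̲)² + conj(tr X̲)² − ((tr X̲)³ + conj(tr X̲)³)/Re(tr X̲)
+ Re((tr X̲)²)((tr X̲)² + conj(tr X̲)²)/(2Re(tr X̲)²)) + ¼(2tr X̲ − 2conj(tr X̲) + ((tr X̲)² + conj(tr X̲)²)/Re(tr X̲))² + r^{−1}𝔡^{≤1}Γ_b = … =
C₂ + 2∇₃(F₂) + r^{−1}𝔡^{≤1}Γ_b`".  Certified: the displayed rational expression (without `2∇₃(F₂)` and the remainder) equals (11.1.5)'s `C₂`.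
[cite: GiorgiKlainermanSzeftel2024, p.481 L20–77; GiorgiKlainermanSzeftel2022, l.20413–20421] -/
theorem lem1113_C2tilde (x y : ℝ) (hx : x ≠ 0) :
    (1/2 : ℂ) * (-(trX x y) ^ 2 + (trXb x y) ^ 2 - ((trX x y) ^ 3 + (trXb x y) ^ 3) / (x : ℂ)
        + (((x ^ 2 - y ^ 2 : ℝ)) : ℂ) * ((trX x y) ^ 2 + (trXb x y) ^ 2) / (2 * (x : ℂ) ^ 2))
      + (1/4 : ℂ) * (2 * trX x y - 2 * trXb x y + ((trX x y) ^ 2 + (trXb x y) ^ 2) / (x : ℂ)) ^ 2 = Cb2 x y := by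
  have hx' : (x : ℂ) ≠ 0 := by exact_mod_cast hx
  simp only [trX, trXb, Cb2]
  push_cast
  field_simp
  ring_nf
  simp only [Complex.I_sq, Complex.I_pow_three, Complex.I_pow_four]
  ring

/-! ## §3 Elementary real arithmetic in the shape of the printed absorption, Young and weight-shift steps

Every norm is a nonnegative real HYPOTHESIS-letter; every "`≲`" an explicit constant; nothing of [J]'s estimates is asserted. -/

/-- Step 3 of the proof of Thm 12.2.4: "As a consequence of Proposition 12.2.9 and Proposition 12.2.7, as well as the smallness of
`|a|/m`, we deduce, for all `s ≤ k_L` and all `δ ≤ p ≤ 2 − δ`, `BEF^s_p[ψ̲, A̲] ≲ E^s_p[ψ̲, A̲](τ₁) + N^s_p[ψ̲, Ñ_err] + ε₀²τ₁^{−2−2δ_dec}`."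
The SHAPE, made quantitative: `U = BEF^s_p[ψ̲]`, `W = BEF^s_p[A̲]`, (12.2.5) `U ≤ C₁(E_ψ + N + d) + C_a·a·(U + W)`, (12.2.7)
`W ≤ C₂(B_δ + E_A + d)` with `B^s_δ[ψ̲] ≤ BEF^s_p[ψ̲]` (`p ≥ δ`), and the smallness `C_a·a·(1 + C₂) ≤ ½` give an explicit bound for
`U + W`.  How small `|a|/m` must be is not printed; here it is the displayed hypothesis `hsmall`. [folklore]
[cite: GiorgiKlainermanSzeftel2024, Step 3, p.553 L52–58; GiorgiKlainermanSzeftel2022, l.22983–22987] -/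
theorem step3_absorption (U W Eψ EA N d Bδ C₁ C₂ Ca a : ℝ) (hU0 : 0 ≤ U) (hC₂ : 0 ≤ C₂) (hCa : 0 ≤ Ca) (ha : 0 ≤ a)
    (h1227 : U ≤ C₁ * (Eψ + N + d) + Ca * a * (U + W)) (h1229 : W ≤ C₂ * (Bδ + EA + d)) (hB : Bδ ≤ U)
    (hsmall : Ca * a * (1 + C₂) ≤ 1 / 2) :
    U + W ≤ 2 * (1 + C₂) * (C₁ * (Eψ + N + d) + Ca * a * C₂ * (EA + d)) + C₂ * (EA + d) := by
  have hW' : W ≤ C₂ * (U + EA + d) := by nlinarith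
  have hCaa : 0 ≤ Ca * a := mul_nonneg hCa ha
  have h2 : Ca * a * W ≤ Ca * a * (C₂ * (U + EA + d)) := mul_le_mul_of_nonneg_left hW' hCaa
  have h3 : Ca * a * (1 + C₂) * U ≤ 1 / 2 * U := mul_le_mul_of_nonneg_right hsmall hU0
  have hU : U ≤ 2 * (C₁ * (Eψ + N + d) + Ca * a * C₂ * (EA + d)) := by nlinarith
  have h4 : (1 + C₂) * U ≤ (1 + C₂) * (2 * (C₁ * (Eψ + N + d) + Ca * a * C₂ * (EA + d))) :=
    mul_le_mul_of_nonneg_left hU (by linarith)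
  nlinarith

/-- Cor 12.2.5 from Thm 12.2.4 and Lemma 12.2.6 ("an immediate consequence"): the Young-inequality SHAPE.  With `X = BEF^s_p[ψ̲, A̲] ≥
BEF^s_p[ψ̲]`, (12.2.2) `X ≤ C(e + n + d)` and (12.2.4) `n ≤ c·X^{1/2}` give `X ≤ 2Ce + C²c² + 2Cd`; here `c = ε₀τ₁^{−1−(3/2)δ_dec+(p+δ)/2}`,
so `c² = ε₀²τ₁^{−2−3δ_dec+p+δ}` (`cor1225_exponent`). [folklore] -/
theorem cor1225_young (X e n d C c : ℝ) (hX : 0 ≤ X) (hC : 0 ≤ C)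
    (h1224 : X ≤ C * (e + n + d)) (h1226 : n ≤ c * Real.sqrt X) :
    X ≤ 2 * C * e + C ^ 2 * c ^ 2 + 2 * C * d := by
  have hs : Real.sqrt X ^ 2 = X := Real.sq_sqrt hX
  have hs0 : 0 ≤ Real.sqrt X := Real.sqrt_nonneg X
  have h1 : C * n ≤ C * (c * Real.sqrt X) := mul_le_mul_of_nonneg_left h1226 hC
  have h2 : 2 * (C * c) * Real.sqrt X ≤ (C * c) ^ 2 + Real.sqrt X ^ 2 := by nlinarith [sq_nonneg (C * c - Real.sqrt X)]
  nlinarith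

/-- The exponent of Cor 12.2.5's middle term is twice Lemma 12.2.6's: `2·(−1 − (3/2)δ_dec + (p + δ)/2) = −2 − 3δ_dec + p + δ`.
[cite: GiorgiKlainermanSzeftel2024, (12.2.3)–(12.2.4), p.552 L18–47] -/
theorem cor1225_exponent (δdec p δ : ℚ) : 2 * (-1 - 3 / 2 * δdec + (p + δ) / 2) = -2 - 3 * δdec + p + δ := by ring

/-- Proof of (12.3.2), the choice of `λ` ([J]: "for `p < 0`, `|p| r|q|^{p−4}|Φ₁|² ≤ λ r|q|^{p−4}|Φ₁|² + λ^{−1}r^{−1}|q|^p|Φ₂|² +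
O(ε)|q|^{p−4}|Φ₁|² − Div(|q|^{p−2}|Φ₁|²e₄)`.  Therefore, for `p ≤ −δ`, choosing `λ = |p|/2`, we deduce, for `ε` sufficiently small,
`r|q|^{p−4}|Φ₁|² ≲ (4/p²) r^{−1}|q|^p|Φ₂|² − (2/|p|)Div(…)`").  The SHAPE with `P = |p| > 0`, `u, v, w` the three real quantities and
the `O(ε)` term dropped: `P·u ≤ (P/2)u + (P/2)^{−1}v + w ⟹ u ≤ (4/P²)v + (2/P)w`; and with an `O(ε)` coefficient `e ≤ P/4` the same with
doubled constants. [folklore]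
[cite: GiorgiKlainermanSzeftel2024, p.559 L70–p.560 L12; GiorgiKlainermanSzeftel2022, l.23214–23241] -/
theorem lem1231_lambda (P u v w e : ℝ) (hP : 0 < P) (hu : 0 ≤ u) :
    (P * u ≤ (P / 2) * u + (P / 2)⁻¹ * v + w → u ≤ 4 / P ^ 2 * v + 2 / P * w) ∧
    (e ≤ P / 4 → P * u ≤ (P / 2) * u + (P / 2)⁻¹ * v + e * u + w → u ≤ 8 / P ^ 2 * v + 4 / P * w) := by
  have hP2 : (P / 2)⁻¹ = 2 / P := by rw [inv_div]
  constructor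
  · intro h
    rw [hP2] at h
    have key : P * u ≤ 2 * (2 / P * v + w) := by linarith
    have : u ≤ (2 * (2 / P * v + w)) / P := by rw [le_div_iff₀ hP]; linarith
    calc u ≤ (2 * (2 / P * v + w)) / P := this
      _ = 4 / P ^ 2 * v + 2 / P * w := by field_simp; ring
  · intro he h
    rw [hP2] at h
    have h3 : e * u ≤ P / 4 * u := mul_le_mul_of_nonneg_right he hu
    have key : P * u ≤ 4 * (2 / P * v + w) := by linarith
    have : u ≤ (4 * (2 / P * v + w)) / P := by rw [le_div_iff₀ hP]; linarith
    calc u ≤ (4 * (2 / P * v + w)) / P := this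
      _ = 8 / P ^ 2 * v + 4 / P * w := by field_simp; ring

/-- The [v1]→[J] sign datum of the same display: [v1] l.23234–23240 prints "`p r|q|^{p−4}|Φ₁|² ≤ …`", "choosing `λ = p/2`", "`−(2/p)Div`"
with `p ≤ −δ < 0`, i.e. a NEGATIVE `λ` (the Cauchy–Schwarz weight `(λr)^{1/2}` needs `λ > 0`); [J] prints `|p|`, `λ = |p|/2`, `2/|p|`.
Certified: for `0 < δ`, `p ≤ −δ` gives `p/2 < 0 < |p|/2` and `4/p² = 4/|p|²`. [folklore]
[cite: GiorgiKlainermanSzeftel2024, p.559 L78–p.560 L12; GiorgiKlainermanSzeftel2022, l.23232–23240] -/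
theorem v1_lambda_sign (p δ : ℚ) (hδ : 0 < δ) (hp : p ≤ -δ) : p / 2 < 0 ∧ 0 < |p| / 2 ∧ 4 / p ^ 2 = 4 / |p| ^ 2 := by
  refine ⟨by linarith, ?_, by rw [sq_abs]⟩
  have : p < 0 := by linarith
  have := abs_pos.mpr (ne_of_lt this)
  linarith

/-- Proof of Prop 12.3.5: the transport estimates are derived "for all `p ≤ −δ`" and then "Replacing `p` with `p − 2` we rewrite, for all
`p ≤ 2 − δ`" — the range shift, and the matching shift of every displayed weight (`r^{p−1} ↦ r^{p−3}`, `r^{p−2} ↦ r^{p−4}`, `r^p ↦ r^{p−2}`).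
[cite: GiorgiKlainermanSzeftel2024, p.566 L5, L61; GiorgiKlainermanSzeftel2022, l.23455, l.23466] -/
theorem prop1235_shift (p δ : ℚ) :
    (p - 2 ≤ -δ ↔ p ≤ 2 - δ) ∧ (p - 2) - 1 = p - 3 ∧ (p - 2) - 2 = p - 4 ∧ (p - 2) = p - 2 := by
  refine ⟨⟨fun h => by linarith, fun h => by linarith⟩, by ring, by ring, rfl⟩

/-- The bootstrap convention `ε = ε₀^{2/3}` (quoted; [KS] (3.4.4)) behind two printed conversions: (12.3.11)'s `ε⁴τ₁^{−2−2δ_dec}` becomes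
`ε₀²τ₁^{−2−2δ_dec}` in the next display ("Hence, for all `p ≤ 2 − δ`, … `+ ε₀²τ₁^{−2−2δ_dec}`"), and Lemma 12.2.8's proof turns
`ε²∫… + ε²(…)^{1/2}` into "`≲ ε₀τ₁^{−1−2δ_dec}`".  Certified for `0 < ε₀ ≤ 1`, writing `ε₀ = t³`, `ε = t²` (`t = ε₀^{1/3} ∈ (0,1]`):
`ε⁴ = t⁸ ≤ t⁶ = ε₀²` and `ε² = t⁴ ≤ t³ = ε₀`. [folklore]
[cite: GiorgiKlainermanSzeftel2024, (12.3.11) and the next display, p.576 L61–80, p.554 L179–p.555 L3; GiorgiKlainermanSzeftel2022, l.23905–23914, l.23027–23031] -/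
theorem eps_convention (t : ℝ) (h0 : 0 ≤ t) (h1 : t ≤ 1) :
    (t ^ 2) ^ 4 ≤ (t ^ 3) ^ 2 ∧ (t ^ 2) ^ 2 ≤ t ^ 3 := by
  constructor
  · have : t ^ 8 ≤ t ^ 6 := pow_le_pow_of_le_one h0 h1 (by norm_num)
    calc (t ^ 2) ^ 4 = t ^ 8 := by ring
      _ ≤ t ^ 6 := this
      _ = (t ^ 3) ^ 2 := by ring
  · have : t ^ 4 ≤ t ^ 3 := pow_le_pow_of_le_one h0 h1 (by norm_num)
    calc (t ^ 2) ^ 2 = t ^ 4 := by ring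
      _ ≤ t ^ 3 := this

/-! ## §4 The ℕ-induction scheme of §12.3.6 -/

/-- §12.3.6: "It remains to recover (12.2.7) and (12.2.8) for `1 ≤ s ≤ k_L`. … 1. We argue by iteration assuming that (12.2.7) and
(12.2.8) hold for some `0 ≤ s ≤ k_L − 1`.  It it true for `s = 0` by the above, and our goal is to prove that (12.2.7) and (12.2.8)
hold with `s` replaced by `s + 1`. … Thus, by iteration, (12.2.7) and (12.2.8) hold for all `s` such that `0 ≤ s ≤ k_L`."  The
scheme, for an arbitrary predicate `P` on levels and top `k`. [folklore]
[cite: GiorgiKlainermanSzeftel2024, §12.3.6, p.580 L73–77, p.582 L9–13; GiorgiKlainermanSzeftel2022, l.24093–24095, l.24136] -/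
theorem sec1236_iteration (P : ℕ → Prop) (k : ℕ) (h0 : P 0) (hstep : ∀ s, s ≤ k - 1 → P s → P (s + 1)) :
    ∀ s, s ≤ k → P s := by
  intro s
  induction s with
  | zero => intro _; exact h0
  | succ n ih => intro hn; exact hstep n (by omega) (ih (by omega))

/-- The scheme instantiated at the printed top: base `sLow12 = 0`, last hypothesis level `iterHyp12Top = k_L − 1`, conclusion up to
`prop1229Top = k_L`. [folklore] -/
theorem sec1236_iteration_top (ks : ℕ) (P : ℕ → Prop) (h0 : P sLow12)
    (hstep : ∀ s, s ≤ iterHyp12Top ks → P s → P (s + 1)) : ∀ s, s ≤ prop1229Top ks → P s := by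
  simp only [sLow12_def, iterHyp12Top_def, prop1229Top_def] at *
  exact sec1236_iteration P (kL ks) h0 hstep

/-! ## §5 Linear ℚ-arithmetic on the exponents displayed in the proof of Lemma 12.2.8 (`s = 0`) and in (12.3.11) -/

/-- Proof of Lemma 12.2.8, `s = 0`: "Since `N_err − Ñ_err = 𝔡^{≤3}(Γ_b·Γ_g)` we have, according to our bootstrap assumptions, both
`N_err − Ñ_err = ε²r^{−3}τ^{−3/2−2δ_dec}`, `N_err − Ñ_err = ε²r^{−2}τ^{−2−2δ_dec}`" — the two products of the rates of (12.1.1)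
(`Γ_g`: `r^{−2}τ^{−1/2−δ_dec}` or `r^{−1}τ^{−1−δ_dec}`; `Γ_b`: `r^{−1}τ^{−1−δ_dec}`): exponent sums only.
[cite: GiorgiKlainermanSzeftel2024, (12.1.1), p.544 L20–25, p.554 L170–178; GiorgiKlainermanSzeftel2022, l.22598–22602, l.23022–23026] -/
theorem lem1228_rate_products (δ : ℚ) :
    (-2 : ℚ) + (-1) = -3 ∧ (-1/2 - δ) + (-1 - δ) = -3/2 - 2 * δ ∧ (-1 : ℚ) + (-1) = -2 ∧ (-1 - δ) + (-1 - δ) = -2 - 2 * δ := by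
  refine ⟨by norm_num, by ring, by norm_num, by ring⟩

/-- Proof of Lemma 12.2.8, `s = 0`, the next display: "Thus, for `δ ≤ p ≤ 2 − δ`, `∫_{τ₁}^{τ₂}‖N_err − Ñ_err‖_{L²(Σ_trap(τ))} +
(∫_𝓜 r^{p+1}|N_err − Ñ_err|²)^{1/2} ≲ ε²∫_{τ₁}^{∞} dτ/τ^{2+2δ_dec} + ε²(∫_𝓜 r^{p+1−6}τ^{−3−4δ_dec})^{1/2} ≲ ε₀τ₁^{−1−2δ_dec}`."
Exponent arithmetic: the trapped piece `∫_{τ₁}^∞ τ^{−2−2δ_dec} ∼ τ₁^{−1−2δ_dec}`; the far piece: `τ`-exponent `((−3−4δ_dec)+1)/2 =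
−1−2δ_dec`; `r`-exponent `p + 1 − 6 = p − 5`, which with the `r²` of the volume element is integrable at infinity iff `p − 3 < −1 ⟺ p < 2`
— the printed upper end `2 − δ` (without the `r²`: iff `p < 4`; the measure is not displayed); and the lemma's CLAIMED rate `−1−δ_dec` is
weaker than the derived `−1−2δ_dec` (`τ₁ ≥ 1`, `δ_dec ≥ 0`). [folklore]
[cite: GiorgiKlainermanSzeftel2024, p.554 L179–p.555 L14, Lemma 12.2.8, p.553 L7–18; GiorgiKlainermanSzeftel2022, l.23027–23035, l.22953–22958] -/
theorem lem1228_s0_exponents (δ p : ℚ) :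
    (-2 - 2 * δ) + 1 = -1 - 2 * δ ∧ ((-3 - 4 * δ) + 1) / 2 = -1 - 2 * δ ∧ (p + 1 - 6 = p - 5) ∧
    ((p - 5) + 2 < -1 ↔ p < 2) ∧ (p - 5 < -1 ↔ p < 4) ∧ (p ≤ 2 - δ → 0 < δ → (p - 5) + 2 < -1) ∧
    (0 ≤ δ → -1 - 2 * δ ≤ -1 - δ) := by
  refine ⟨by ring, by ring, by ring, ⟨fun h => by linarith, fun h => by linarith⟩, ⟨fun h => by linarith, fun h => by linarith⟩,
    fun h1 h2 => by linarith, fun h => by linarith⟩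

/-- Proof of Lemma 12.2.8, higher `s`: the interpolation "additional `τ₁^{δ₀}`" turns the derived rate `−1−2δ_dec` into `−1−2δ_dec+δ₀`,
which is still at least as good as the CLAIMED `−1−δ_dec` iff `δ₀ ≤ δ_dec` (the text does not print this constraint here; [53] (5.2.3)–(5.2.4)
and [KS] (3.6.3) fix `δ₀` far below `δ_dec`, cf. `FullRWInteriorLedger.schw_delta0_le_iff`). [folklore]
[cite: GiorgiKlainermanSzeftel2024, p.555 L15–28; GiorgiKlainermanSzeftel2022, l.23037–23047] -/
theorem lem1228_interp_loss (δdec δ0 : ℚ) : (-1 - 2 * δdec + δ0 ≤ -1 - δdec ↔ δ0 ≤ δdec) :=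
  ⟨fun h => by linarith, fun h => by linarith⟩

/-- (12.3.11): "`∫_{𝓜(τ₁,τ₂)} r^{p−1}|𝔡^{≤1}(Γ_b·Γ_b)|² ≲ ε⁴τ₁^{−2−2δ_dec}` which holds true for `p ≤ 2 − δ`": with `Γ_b`'s rate
`r^{−1}τ^{−1−δ_dec}` of (12.1.1), `|Γ_b·Γ_b|² ∼ ε⁴r^{−4}τ^{−4−4δ_dec}`; the `r`-exponent `(p−1) − 4 (+2 volume)` is integrable at infinity
iff `p < 2` — again exactly the printed upper end; the `τ`-exponent `(−4−4δ_dec)+1 = −3−4δ_dec ≤ −2−2δ_dec`. [folklore]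
[cite: GiorgiKlainermanSzeftel2024, (12.3.11), p.576 L61–73, (12.1.1), p.544 L20–25; GiorgiKlainermanSzeftel2022, l.23905–23910] -/
theorem lem1239_exponents (δ p : ℚ) :
    2 * (2 * (-1 : ℚ)) = -4 ∧ 2 * (2 * (-1 - δ)) = -4 - 4 * δ ∧ ((p - 1) - 4 + 2 < -1 ↔ p < 2) ∧
    (-4 - 4 * δ) + 1 = -3 - 4 * δ ∧ (0 ≤ δ → -3 - 4 * δ ≤ -2 - 2 * δ) := by
  refine ⟨by norm_num, by ring, ⟨fun h => by linarith, fun h => by linarith⟩, by ring, fun h => by linarith⟩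

end Literature.Geometry.Lorentzian.GiorgiKlainermanSzeftel2022.AbarDecayInteriorLedger
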